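import Mathlib
import Summits.NavierStokesRegularity.NavierStokesRegularity.Theorems.TaoLadderRungTwoBreakBlowupRigidityOneSmallData
import HarnessLib

/-!
# How robust can a robust blow-up be? — an explicit bound on the defect budget a one-shell datum of an `E₂(R)` table
  can resist (numbers for the hypothesis `NoGlobalCascade ε₀ α X₀` of K2(1) `TaoLadderRungTwoBreak.BlowupRigidityOne`,
  stmt-NavierStokesRegularity-20206)

MODEL lattice ODEs only (Tao 2016 §4 Lemma 4.1 (4.5)–(4.11), Thm. 4.2 statement shape, the viscous lattice); nothing
here is a statement about the Navier–Stokes equations; NO item is closed (`--supports stmt-NavierStokesRegularity-20206`).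
Route-independent module; general `m`; DEF-FREE.

Robust blow-up in the κ-normal form (`noGlobalCascade_iff_kappa`) = «for SOME budget `κ > 0` there is no global
`(κ,κ)`-pseudo-solution from the datum at shell `0`». This file bounds that budget from above, explicitly:

* `exists_viscousGlobal_of_smallDatum_of_inTableClass` — the small-data theorem of `…SmallData` for the tables of
  `E₂(R)` (structure constants of modulus `≤ 1` on the shift set; restriction `restrictShiftSet`): `|X₀ᵢ| ≤ δ/2` and
  `8 m² (1+ε₀)^{16} δ < ν` ⇒ a global regular `ν`-viscous solution;
* `hasGlobal_of_largeBudget` — hence EVERY datum `X₀` of every `E₂(R)` table carries a global `(κ,κ)`-pseudo-solution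
  from shell `0` for every budget `κ > 8√2 m² (1+ε₀)^{16} (2‖X₀‖ + 1)` (`hasGlobal_of_viscousGlobal`, `hasGlobal_mono`);
* `robustBudget_le` — so the budgets witnessing a robust blow-up are confined to
  `κ ≤ 8√2 m² (1+ε₀)^{16} (2‖X₀‖ + 1)` (for `m = 4`: `κ ≤ 128√2 (1+ε₀)^{16}(2‖X₀‖+1)`); with the 0-homogeneity
  `noGlobalCascade_datumScale_iff` (…DatumScaling) the scale-free content is «the critical budget is `O(‖X₀‖)`».

HONEST LABEL: a quantitative remark on the hypothesis of the crux (dissipation-dominated regime, BMR mechanism already in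
the tree as `largeNuRegular`); no stub, crux or summit is proved; rung 0.
-/

noncomputable section

-- the summit and its single sub-problem share the name (CONVENTIONS §1)
set_option linter.dupNamespace false

open Set Filter Topology

namespace Summit.NavierStokesRegularity.NavierStokesRegularity.Theorems

namespace BlowupRigidityOne

open Literature.Analysis.FluidPDE Literature.Analysis.FluidPDE.TaoCascade

variable {m : ℕ}

/-- **Small data of an `E₂(R)` table are globally regular** (the small-data theorem for the comparable class: structure
constants bounded by `1` on Tao's shift set, the only shifts the motion reads). For `ε₀ > 0`, `ν > 0`, `α ∈ E₂(R)`,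
`|X₀ᵢ| ≤ δ/2` with `8 m² (1+ε₀)^{16} δ < ν`: `∃ X, ViscousGlobal ε₀ ν α X₀ X`.
[cite: Tao2016AveragedNS, §4 Lemma 4.1 (4.5)–(4.11), the viscous lattice before Thm. 4.2, §6.1; BarbatoMorandinRomito2011, §3.1 Prop. 3.3] -/
theorem exists_viscousGlobal_of_smallDatum_of_inTableClass {ε₀ ν R δ : ℝ} (hε : 0 < ε₀) (hν : 0 < ν) (hδ : 0 < δ)
    {α : Fin m → Fin m → Fin m → ℤ × ℤ × ℤ → ℝ} (hα : InTableClass R α)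
    (hsmall : 8 * (m : ℝ) ^ 2 * (1 + ε₀) ^ (16 : ℝ) * δ < ν)
    {X₀ : Fin m → ℝ} (hX₀ : ∀ i, |X₀ i| ≤ δ / 2) :
    ∃ X : Fin m → ℤ → ℝ → ℝ, ViscousGlobal ε₀ ν α X₀ X := by
  have hα1 := abs_restrictShiftSet_le zero_le_one (abs_le_one_of_inTableClass hα)
  have hsmall' : 8 * (m : ℝ) ^ 2 * 1 * (1 + ε₀) ^ (16 : ℝ) * δ < ν := by simpa using hsmall
  obtain ⟨X, hX⟩ := exists_viscousGlobal_of_smallDatum hε hν zero_le_one hδ hα1 hsmall' hX₀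
  exact ⟨X, hX.of_restrictShiftSet⟩

/-- **Every datum carries a global pseudo-solution at a large enough budget, explicitly.** For `ε₀ > 0`, `α ∈ E₂(R)`,
any one-shell datum `X₀` and every `κ > 8√2 m² (1+ε₀)^{16} (2‖X₀‖+1)`: `HasGlobal ε₀ α κ κ 0 X₀` (the global regular
solution at viscosity `ν = κ/√2 > 8 m² (1+ε₀)^{16}(2‖X₀‖+1)` is a global `(κ,0)`-pseudo-solution, `hasGlobal_of_viscousGlobal`).
[cite: Tao2016AveragedNS, §4 Lemma 4.1 (4.5)–(4.11) and the remark after (4.11); cell vocabulary (`HasGlobal`)] -/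
theorem hasGlobal_of_largeBudget {ε₀ R κ : ℝ} (hε : 0 < ε₀)
    {α : Fin m → Fin m → Fin m → ℤ × ℤ × ℤ → ℝ} (hα : InTableClass R α) (X₀ : Fin m → ℝ)
    (hκ : 8 * Real.sqrt 2 * (m : ℝ) ^ 2 * (1 + ε₀) ^ (16 : ℝ) * (2 * ‖X₀‖ + 1) < κ) :
    HasGlobal ε₀ α κ κ 0 X₀ := by
  have h2 : 0 < Real.sqrt 2 := Real.sqrt_pos.2 two_pos
  have hδ : 0 < 2 * ‖X₀‖ + 1 := by positivity
  set ν : ℝ := κ / Real.sqrt 2 with hν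
  have hsmall : 8 * (m : ℝ) ^ 2 * (1 + ε₀) ^ (16 : ℝ) * (2 * ‖X₀‖ + 1) < ν := by
    rw [hν, lt_div_iff₀ h2]
    calc 8 * (m : ℝ) ^ 2 * (1 + ε₀) ^ (16 : ℝ) * (2 * ‖X₀‖ + 1) * Real.sqrt 2
        = 8 * Real.sqrt 2 * (m : ℝ) ^ 2 * (1 + ε₀) ^ (16 : ℝ) * (2 * ‖X₀‖ + 1) := by ring
      _ < κ := hκ
  have hνpos : 0 < ν := lt_of_le_of_lt (by positivity) hsmall
  obtain ⟨X, hX⟩ := exists_viscousGlobal_of_smallDatum_of_inTableClass hε hνpos hδ hα hsmall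
    (X₀ := X₀) fun i => by
      have := norm_le_pi_norm X₀ i
      rw [Real.norm_eq_abs] at this
      linarith
  have hG := hasGlobal_of_viscousGlobal hε hνpos.le hX
  rw [hν, div_mul_cancel₀ κ h2.ne'] at hG
  have hκ0 : 0 ≤ κ := (mul_nonneg hνpos.le h2.le).trans_eq (by rw [hν, div_mul_cancel₀ κ h2.ne'])
  exact hasGlobal_mono hε.le hG le_rfl hκ0

/-- **HOW ROBUST CAN ROBUST BE.** For `ε₀ > 0`, `α ∈ E₂(R)` and a one-shell datum `X₀`, every defect budget `κ`
WITHOUT a global `(κ,κ)`-pseudo-solution from shell `0` — in particular the budget witnessing `NoGlobalCascade ε₀ α X₀`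
in its κ-normal form — satisfies `κ ≤ 8√2 m² (1+ε₀)^{16} (2‖X₀‖ + 1)`.
[cite: Tao2016AveragedNS, §4 Thm. 4.2 (statement shape), Lemma 4.1; cell vocabulary (`NoGlobalCascade`, `HasGlobal`)] -/
theorem robustBudget_le {ε₀ R κ : ℝ} (hε : 0 < ε₀)
    {α : Fin m → Fin m → Fin m → ℤ × ℤ × ℤ → ℝ} (hα : InTableClass R α) {X₀ : Fin m → ℝ}
    (hno : ¬ HasGlobal ε₀ α κ κ 0 X₀) :
    κ ≤ 8 * Real.sqrt 2 * (m : ℝ) ^ 2 * (1 + ε₀) ^ (16 : ℝ) * (2 * ‖X₀‖ + 1) := by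
  by_contra h
  exact hno (hasGlobal_of_largeBudget hε hα X₀ (not_le.1 h))

/-- **The κ-normal form with a ceiling**: `NoGlobalCascade ε₀ α X₀` on an `E₂(R)` table (`ε₀ > 0`) iff for some budget
`0 < κ ≤ 8√2 m² (1+ε₀)^{16}(2‖X₀‖+1)` there is no global `(κ,κ)`-pseudo-solution from shell `0`.
[cite: Tao2016AveragedNS, §4 Thm. 4.2 (statement shape); cell vocabulary (`NoGlobalCascade`)] -/
theorem noGlobalCascade_iff_kappa_le {ε₀ R : ℝ} (hε : 0 < ε₀)
    {α : Fin m → Fin m → Fin m → ℤ × ℤ × ℤ → ℝ} (hα : InTableClass R α) {X₀ : Fin m → ℝ} :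
    NoGlobalCascade ε₀ α X₀ ↔ ∃ κ : ℝ, 0 < κ ∧ κ ≤ 8 * Real.sqrt 2 * (m : ℝ) ^ 2 * (1 + ε₀) ^ (16 : ℝ) * (2 * ‖X₀‖ + 1) ∧
      ¬ HasGlobal ε₀ α κ κ 0 X₀ := by
  rw [noGlobalCascade_iff_kappa hε]
  constructor
  · rintro ⟨κ, hκ, hno⟩
    exact ⟨κ, hκ, robustBudget_le hε hα hno, hno⟩
  · rintro ⟨κ, hκ, -, hno⟩
    exact ⟨κ, hκ, hno⟩

end BlowupRigidityOne

end Summit.NavierStokesRegularity.NavierStokesRegularity.Theorems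

end
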